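import Summits.ResolutionOfSingularities.ResolutionOfSingularities.Theorems.MarkedTransferCampaignW24ReducedBridgePHasse
import Summits.ResolutionOfSingularities.ResolutionOfSingularities.Theorems.MarkedTransferCampaignW24ReducedBridgeQRun
import HarnessLib

/-!
# The LEVEL-`q` bridge at an ARBITRARY PRIME `p`, part 2: data at level `e ≥ 1` (`q = p^e`, one variable, characteristic `p`) for carriers
# `F = Φ_{q,r₀} G + R` — top residue `r₀`, passenger `R` below it in base `p` (HIRONAKA-L · cell `res-hironaka` · slot W2.4 «bottom-member
# re-run»; the `p = 2` case is res-D-pv-020's `…ReducedBridgeQDatum.lean`)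

**HONEST FRAMING.** OURS throughout: kernel theorems connecting OURS objects of the cell (res-L1-k24's `CampaignW24.ReducedRun`, res-type-059's
`CampaignW24.stepAt` etc., res-D-pv-020's `CampaignW24.ReducedBridge`). Nothing below is a statement of H. Hironaka's manuscript [Hironaka2017]
(lit key `paper:url-3343fd9e678b`), nothing asserts that any statement of it holds, nothing is a claim about resolution of singularities in
characteristic `p`; the manuscript stays «under review» (D-0012/D-0089). AI work, weaker than expert review. Written by res-D-pv-020 (W2.4 lineage).

## What is proved (`K` a field of characteristic `p`, `p` prime; `0 < e ≤ ℓ`; `q = p^e`; `F = Φ_{q,r₀} G + R`, `r₀ < q`, `ResIn q good R`,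
## `good ⊆ PairLTP p · r₀`)
* §1 base-`p` digit bookkeeping for data of depth `ℓ` at level `e` (`n = 1`): `digit_mod_div`, `digits_ltP`, `expo_modP`, `single_digitsP`.
* §2 data of `F` (`G ≠ 0`, `ord G = k`): top pair = base-`p` digits of `r₀` (`alpha_beta_of_levelP`), `γ_* = k·e₀`, `DepthBox ⟺ k < p^{ℓ−e}`,
  `u_* = Ψ_q(unitPart p^{ℓ−e} k G)` under `SoleBottom`, `w = Ψ_q((unitPart …)⁻¹)`.
Hypotheses: each theorem's own binders; no FACT-LIST fact, no DEFECT binder. Standard axioms only.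
-/

noncomputable section

set_option linter.dupNamespace false -- mandated namespace of this single-conjunct summit

namespace Summit.ResolutionOfSingularities.ResolutionOfSingularities.Theorems

namespace CampaignW24

namespace ReducedBridgeP

open Literature.AlgebraicGeometry.Hironaka2017.S08UnitMonomial (StandardExpression)
open Literature.AlgebraicGeometry.Hironaka2017.S09LLUED
open Literature.AlgebraicGeometry.Hironaka2017.S09LLUED.TopFrontier
open Literature.AlgebraicGeometry.Hironaka2017.S09LLUED.TopDeriv
open Literature.AlgebraicGeometry.Hironaka2017.S09LLUED.FrontierDrop (expo)
open Literature.RingTheory.MvPowerSeries (hasseDeriv coeff_hasseDeriv)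
open CampaignW21 (xs hasseD)
open ReducedBridge

variable {K : Type} [Field K]

/-- `p^e ≠ 0` for a prime `p`. [folklore] -/
theorem ppow_ne_zero (p : ℕ) [hp : Fact p.Prime] (e : ℕ) : (p ^ e : ℕ) ≠ 0 := pow_ne_zero e hp.out.ne_zero

/-! ## §1 Base-`p` digit bookkeeping at level `e` (`n = 1`) -/

omit [Field K] in
/-- Base-`p` digits of `a + p·b` (`a < p`). [folklore] -/
theorem digit_mod_div {p a b : ℕ} (hp : 0 < p) (ha : a < p) : (a + p * b) % p = a ∧ (a + p * b) / p = b := by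
  constructor
  · rw [Nat.add_mul_mod_self_left, Nat.mod_eq_of_lt ha]
  · rw [Nat.add_mul_div_left _ _ hp, Nat.div_eq_of_lt ha, zero_add]

section Digits

variable {p : ℕ} [hp : Fact p.Prime] {e ℓ : ℕ} {F : MvPowerSeries (Fin 1) K}

omit hp in
/-- The two digits of a summand combine to a residue `< p^e` (`a < p`, `b < p^{e−1}`, `e ≥ 1`). [folklore] -/
theorem digits_ltP (X : StandardExpression p (xs K 1) e ℓ F) (he : 0 < e) {s : ExpTriple 1} (hs : s ∈ X.support) :
    s.1 0 + p * s.2.1 0 < p ^ e := by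
  have ha := X.a_lt _ hs 0
  have hb := X.b_lt _ hs 0
  have h2 : p * p ^ (e - 1) = p ^ e := by rw [← pow_succ']; congr 1; omega
  calc s.1 0 + p * s.2.1 0 < p + p * s.2.1 0 := by omega
    _ = p * (s.2.1 0 + 1) := by ring
    _ ≤ p * p ^ (e - 1) := Nat.mul_le_mul_left _ hb
    _ = p ^ e := h2

omit hp in
/-- The residue of the exponent of a summand is `a + p·b`. [folklore] -/
theorem expo_modP (X : StandardExpression p (xs K 1) e ℓ F) (he : 0 < e) {s : ExpTriple 1} (hs : s ∈ X.support) :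
    expo p e s 0 % p ^ e = s.1 0 + p * s.2.1 0 := by
  have h := digits_ltP X he hs
  rw [expo]
  simp only [Finsupp.add_apply, Finsupp.smul_apply, smul_eq_mul]
  rw [Nat.add_mul_mod_self_left, Nat.mod_eq_of_lt h]

omit hp in
/-- The residue of a monomial is read off the summand carrying it. [folklore] -/
theorem residue_of_eqP (X : StandardExpression p (xs K 1) e ℓ F) (he : 0 < e) {s : ExpTriple 1} (hs : s ∈ X.support)
    {d r : Fin 1 →₀ ℕ} (hd : d = s.1 + p • s.2.1 + p ^ e • r) : d 0 % p ^ e = s.1 0 + p * s.2.1 0 := by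
  subst hd
  simp only [Finsupp.add_apply, Finsupp.smul_apply, smul_eq_mul]
  rw [Nat.add_mul_mod_self_left, Nat.mod_eq_of_lt (digits_ltP X he hs)]

omit [Field K] hp in
/-- `single (r % p) + p • single (r / p) = single r` on `Fin 1`. [folklore] -/
theorem single_digitsP (r : ℕ) : Finsupp.single (0 : Fin 1) (r % p) + p • Finsupp.single (0 : Fin 1) (r / p) = Finsupp.single 0 r := by
  rw [Finsupp.smul_single, ← Finsupp.single_add]; congr 1; rw [smul_eq_mul]; exact Nat.mod_add_div r p

/-- Digits below `r₀` ⇒ pair key below the digit pair of `r₀`. [folklore] -/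
theorem pairKey_lt_of_pairLTPP (X : StandardExpression p (xs K 1) e ℓ F) {s : ExpTriple 1} (hs : s ∈ X.support) {r₀ : ℕ}
    (h : PairLTP p (s.1 0 + p * s.2.1 0) r₀) :
    pairKey s < toLex (toLex (Finsupp.single (0 : Fin 1) (r₀ % p)), toLex (Finsupp.single (0 : Fin 1) (r₀ / p))) := by
  obtain ⟨hm, hd⟩ := digit_mod_div (b := s.2.1 0) hp.out.pos (X.a_lt _ hs 0)
  rw [PairLTP, hm, hd] at h
  rw [pairKey, eq_single s.1, eq_single s.2.1]
  rcases h with h | ⟨h1, h2⟩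
  · exact Prod.Lex.toLex_lt_toLex.mpr (Or.inl (toLex_single_lt_iff.mpr h))
  · rw [h1]; exact Prod.Lex.toLex_lt_toLex.mpr (Or.inr ⟨rfl, toLex_single_lt_iff.mpr h2⟩)

/-- Pair key at most the digit pair of `r₀` ⇒ the residue is `r₀` or below it. [folklore] -/
theorem eq_or_pairLTP_of_pairKey_leP (X : StandardExpression p (xs K 1) e ℓ F) {s : ExpTriple 1} (hs : s ∈ X.support) {r₀ : ℕ}
    (h : pairKey s ≤ toLex (toLex (Finsupp.single (0 : Fin 1) (r₀ % p)), toLex (Finsupp.single (0 : Fin 1) (r₀ / p)))) :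
    s.1 0 + p * s.2.1 0 = r₀ ∨ PairLTP p (s.1 0 + p * s.2.1 0) r₀ := by
  obtain ⟨hm, hd⟩ := digit_mod_div (b := s.2.1 0) hp.out.pos (X.a_lt _ hs 0)
  rw [PairLTP, hm, hd]
  rw [pairKey, eq_single s.1, eq_single s.2.1] at h
  rcases Prod.Lex.toLex_le_toLex.mp h with hlt | ⟨heq, hle⟩
  · exact Or.inr (Or.inl (toLex_single_lt_iff.mp hlt))
  · have h1 : s.1 0 = r₀ % p := Finsupp.single_injective _ (toLex_inj.mp heq)
    have h2 : s.2.1 0 ≤ r₀ / p := toLex_single_le_iff.mp hle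
    rcases Nat.lt_or_ge (s.2.1 0) (r₀ / p) with hlt | hge
    · exact Or.inr (Or.inr ⟨h1, hlt⟩)
    · left
      have hb : s.2.1 0 = r₀ / p := le_antisymm h2 hge
      rw [h1, hb]
      exact Nat.mod_add_div r₀ p

end Digits

/-! ## §2 Data of `F = Φ_{q,r₀} G + R` at level `e` -/

section Datum

variable {p : ℕ} [hp : Fact p.Prime] {e ℓ : ℕ} {F R : MvPowerSeries (Fin 1) K} {G : PowerSeries K} {r₀ : ℕ} {good : ℕ → Prop}

/-- The top residue class reads `G`: `coeff_{r₀ + q·m} F = coeff_m G`. [folklore] -/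
theorem coeff_top_residueP (hF : F = phiQ (p ^ e) (ppow_ne_zero p e) r₀ G + R) (hr₀ : r₀ < p ^ e) (hR : ResIn (p ^ e) good R)
    (hgood : ∀ ρ, good ρ → PairLTP p ρ r₀) (m : ℕ) :
    MvPowerSeries.coeff (Finsupp.single 0 (r₀ + p ^ e * m)) F = PowerSeries.coeff m G := by
  rw [hF, map_add, coeff_phiQ_add _ hr₀, hR.coeff_eq_zero, add_zero]
  rw [Finsupp.single_eq_same, Nat.add_mul_mod_self_left, Nat.mod_eq_of_lt hr₀]
  exact fun h => (hgood _ h).ne rfl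

/-- Off the top residue class `F` reads the passenger. [folklore] -/
theorem coeff_off_residueP (hF : F = phiQ (p ^ e) (ppow_ne_zero p e) r₀ G + R) (hr₀ : r₀ < p ^ e) {d : Fin 1 →₀ ℕ}
    (hd : d 0 % p ^ e ≠ r₀) : MvPowerSeries.coeff d F = MvPowerSeries.coeff d R := by
  rw [hF, map_add, coeff_phiQ_of_lt _ hr₀, if_neg hd, zero_add]

variable [CharP K p]

/-- **Top pair of every datum** of `F` (`G ≠ 0`, depth `ℓ ≥ e > 0`): `(α, β)` are the base-`p` digits `(r₀ % p, r₀ / p)` of the top residue.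
[folklore] -/
theorem alpha_beta_of_levelP (X : StandardExpression p (xs K 1) e ℓ F) (hF : F = phiQ (p ^ e) (ppow_ne_zero p e) r₀ G + R)
    (hr₀ : r₀ < p ^ e) (hR : ResIn (p ^ e) good R) (hgood : ∀ ρ, good ρ → PairLTP p ρ r₀) (he : 0 < e) (hle : e ≤ ℓ) (hG : G ≠ 0) :
    alpha X.support X.u = Finsupp.single 0 (r₀ % p) ∧ beta X.support X.u = Finsupp.single 0 (r₀ / p) := by
  -- a visible top-residue monomial and its effective summand `s`
  obtain ⟨k, hk⟩ : ∃ k, PowerSeries.coeff k G ≠ 0 := by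
    by_contra h
    push Not at h
    exact hG (PowerSeries.ext fun k => by rw [h k, map_zero])
  have hc : MvPowerSeries.coeff (Finsupp.single 0 (r₀ + p ^ e * k)) F ≠ 0 := by rwa [coeff_top_residueP hF hr₀ hR hgood]
  obtain ⟨s, hs, r, hr⟩ := exists_mem_effSupport_of_coeff_ne_zero hle X hc
  have hss := (mem_effSupport.mp hs).1
  have hs_dig : s.1 0 + p * s.2.1 0 = r₀ := by
    rw [← residue_of_eqP X he hss hr, Finsupp.single_eq_same, Nat.add_mul_mod_self_left, Nat.mod_eq_of_lt hr₀]
  obtain ⟨hs1, hs2⟩ : r₀ % p = s.1 0 ∧ r₀ / p = s.2.1 0 := hs_dig ▸ digit_mod_div hp.out.pos (X.a_lt _ hss 0)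
  -- the top summand `t` and a visible monomial of its residue
  obtain ⟨t, ht, h1, h2⟩ := exists_top_of_nonempty ⟨s, hs⟩
  obtain ⟨m, hm, hmod⟩ := TopDeriv.exists_coeff_ne_zero_of_mem_effSupport he hle X ht
  have hts := (mem_effSupport.mp ht).1
  have hres : m 0 % p ^ e = t.1 0 + p * t.2.1 0 := by rw [← expo_modP X he hts]; exact hmod 0
  by_cases hρ : m 0 % p ^ e = r₀
  · -- the top summand has the digits of `r₀`
    obtain ⟨ht1, ht2⟩ : r₀ % p = t.1 0 ∧ r₀ / p = t.2.1 0 :=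
      (hres.symm.trans hρ) ▸ digit_mod_div hp.out.pos (X.a_lt _ hts 0)
    rw [← h1, ← h2, eq_single t.1, eq_single t.2.1, ← ht1, ← ht2]
    exact ⟨rfl, rfl⟩
  · -- otherwise the top pair lies strictly below the pair of `s`: contradiction with `pairKey_le_top`
    exfalso
    have hmR : MvPowerSeries.coeff m R ≠ 0 := by rwa [coeff_off_residueP hF hr₀ hρ] at hm
    have hlt : PairLTP p (t.1 0 + p * t.2.1 0) r₀ := hres ▸ hgood _ (hR m hmR)
    have hle_s := pairKey_le_top hs
    have htop : toLex (toLex (alpha X.support X.u), toLex (beta X.support X.u)) < pairKey s := by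
      have hkey := pairKey_lt_of_pairLTPP X hts hlt
      rw [← h1, ← h2, pairKey, eq_single s.1, eq_single s.2.1, ← hs1, ← hs2]
      rw [pairKey] at hkey
      exact hkey
    exact absurd (lt_of_lt_of_le htop hle_s) (lt_irrefl _)

/-- **`γ_* = k·e₀`** (`ord G = k`) on every datum of `F` with non-empty top block. [folklore] -/
theorem gammaStar_of_levelP (X : StandardExpression p (xs K 1) e ℓ F) (hF : F = phiQ (p ^ e) (ppow_ne_zero p e) r₀ G + R)
    (hr₀ : r₀ < p ^ e) (hR : ResIn (p ^ e) good R) (hgood : ∀ ρ, good ρ → PairLTP p ρ r₀) (he : 0 < e) (hle : e ≤ ℓ)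
    (h0 : 0 < frontierLength X.support X.u) {k : ℕ} (hk : PowerSeries.order G = k) :
    gammaStar X.support X.u = Finsupp.single 0 k := by
  have hG : G ≠ 0 := fun h => by rw [h, PowerSeries.order_zero] at hk; exact ENat.top_ne_coe k hk
  obtain ⟨hα, hβ⟩ := alpha_beta_of_levelP X hF hr₀ hR hgood he hle hG
  obtain ⟨hk0, hklt⟩ := PowerSeries.order_eq_nat.mp hk
  have hAB : topFrontierExp p X.support X.u = Finsupp.single 0 r₀ := by rw [topFrontierExp, hα, hβ, single_digitsP]
  have hc := coeff_bottomExp_ne_zero X he hle h0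
  have hbot : bottomExp p e X.support X.u = Finsupp.single 0 (r₀ + p ^ e * gammaStar X.support X.u 0) := by
    rw [bottomExp, ← topFrontierExp, hAB, eq_single (gammaStar X.support X.u)]
    refine Finsupp.ext fun s => ?_
    have hs : s = 0 := Subsingleton.elim _ _
    subst hs
    simp only [Finsupp.add_apply, Finsupp.smul_apply, Finsupp.single_eq_same, smul_eq_mul]
  rw [hbot, coeff_top_residueP hF hr₀ hR hgood] at hc
  have h1 : k ≤ gammaStar X.support X.u 0 := by
    by_contra hlt
    exact hc (hklt _ (by omega))
  have h2 := toLex_gammaStar_le_of_coeff_ne_zero X he hle h0 (c := Finsupp.single 0 k) (by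
    have : topFrontierExp p X.support X.u + p ^ e • Finsupp.single 0 k = Finsupp.single 0 (r₀ + p ^ e * k) := by
      rw [hAB, Finsupp.smul_single, ← Finsupp.single_add, smul_eq_mul]
    rw [this, coeff_top_residueP hF hr₀ hR hgood]
    exact hk0)
  have h3 : Finsupp.single 0 k ≤ gammaStar X.support X.u := by
    intro s
    have hs : s = 0 := Subsingleton.elim _ _
    subst hs
    simpa using h1
  exact (toLex_inj.mp (le_antisymm (Finsupp.toLex_monotone h3) h2)).symm

/-- **`DepthBox ⟺ k < p^{ℓ−e}`** on a datum of `F` (`ord G = k`, `e ≤ ℓ`). [folklore] -/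
theorem depthBox_iff_of_levelP (X : StandardExpression p (xs K 1) e ℓ F) (hF : F = phiQ (p ^ e) (ppow_ne_zero p e) r₀ G + R)
    (hr₀ : r₀ < p ^ e) (hR : ResIn (p ^ e) good R) (hgood : ∀ ρ, good ρ → PairLTP p ρ r₀) (he : 0 < e) (hle : e ≤ ℓ)
    (h0 : 0 < frontierLength X.support X.u) {k : ℕ} (hk : PowerSeries.order G = k) :
    DepthBox p e ℓ X.support X.u ↔ k < p ^ (ℓ - e) := by
  rw [DepthBox, gammaStar_of_levelP X hF hr₀ hR hgood he hle h0 hk]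
  have h2 : p ^ ℓ = p ^ e * p ^ (ℓ - e) := by rw [← pow_add]; congr 1; omega
  have hq : 0 < p ^ e := pow_pos hp.out.pos e
  constructor
  · intro h
    have := h 0
    simp only [Finsupp.smul_apply, Finsupp.single_eq_same, smul_eq_mul] at this
    rw [h2] at this
    exact Nat.lt_of_mul_lt_mul_left this
  · intro h s
    have hs : s = 0 := Subsingleton.elim _ _
    subst hs
    simp only [Finsupp.smul_apply, Finsupp.single_eq_same, smul_eq_mul]
    rw [h2]
    exact Nat.mul_lt_mul_of_pos_left h hq

/-- **`u_* = Ψ_q(unitPart p^{ℓ−e} k G)`** under `SoleBottom` — class isolation reads the top residue class, where the passenger is absent.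
[folklore] -/
theorem uStar_of_levelP (X : StandardExpression p (xs K 1) e ℓ F) (hF : F = phiQ (p ^ e) (ppow_ne_zero p e) r₀ G + R)
    (hr₀ : r₀ < p ^ e) (hR : ResIn (p ^ e) good R) (hgood : ∀ ρ, good ρ → PairLTP p ρ r₀) (he : 0 < e) (hle : e ≤ ℓ)
    (h0 : 0 < frontierLength X.support X.u) {k : ℕ} (hk : PowerSeries.order G = k) (hsole : SoleBottom p e ℓ X.support X.u) :
    uStar X.support X.u = psiQ (p ^ e) (ppow_ne_zero p e) (ReducedRun.unitPart (p ^ (ℓ - e)) k G) := by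
  have hG : G ≠ 0 := fun h => by rw [h, PowerSeries.order_zero] at hk; exact ENat.top_ne_coe k hk
  obtain ⟨hα, hβ⟩ := alpha_beta_of_levelP X hF hr₀ hR hgood he hle hG
  have hγ := gammaStar_of_levelP X hF hr₀ hR hgood he hle h0 hk
  have h2 : p ^ ℓ = p ^ e * p ^ (ℓ - e) := by rw [← pow_add]; congr 1; omega
  have hqpos : 0 < p ^ e := pow_pos hp.out.pos e
  ext d
  by_cases hd : p ^ ℓ ∣ d 0
  · obtain ⟨m, hm⟩ := hd
    have hdμ : d = p ^ ℓ • Finsupp.single 0 m := by rw [eq_single d, hm, Finsupp.smul_single, smul_eq_mul]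
    have h1 := coeff_bottomExp_add_eq_coeff_uStar X he hle h0 hsole (Finsupp.single 0 m)
    rw [← hdμ] at h1
    rw [← h1]
    have h3 : bottomExp p e X.support X.u + d = Finsupp.single 0 (r₀ + p ^ e * (k + p ^ (ℓ - e) * m)) := by
      rw [bottomExp, ← topFrontierExp, topFrontierExp, hα, hβ, single_digitsP, hγ, eq_single d, hm, h2]
      refine Finsupp.ext fun s => ?_
      have hs : s = 0 := Subsingleton.elim _ _
      subst hs
      simp only [Finsupp.add_apply, Finsupp.smul_apply, Finsupp.single_eq_same, smul_eq_mul]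
      ring
    rw [h3, coeff_top_residueP hF hr₀ hR hgood, coeff_psiQ, eq_single d, Finsupp.single_eq_same, hm, h2, mul_assoc,
      if_pos (Nat.mul_mod_right _ _), Nat.mul_div_cancel_left _ hqpos, ReducedRun.coeff_unitPart, if_pos (dvd_mul_right _ _), add_comm]
  · rw [coeff_uStar_eq_zero_of_not_dvd X h0 ⟨0, hd⟩, coeff_psiQ]
    split_ifs with h0q
    · rw [ReducedRun.coeff_unitPart, if_neg]
      intro hP
      apply hd
      have hdq := eq_add_mul_div_of_mod_eq (q := p ^ e) h0q
      rw [zero_add] at hdq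
      obtain ⟨c, hc⟩ := hP
      rw [hdq, hc, h2, ← mul_assoc]
      exact dvd_mul_right _ _
    · rfl

/-- A legal inverse of `u_*` is `Ψ_q((unitPart …)⁻¹)`. [folklore] -/
theorem inv_of_levelP (X : StandardExpression p (xs K 1) e ℓ F) (hF : F = phiQ (p ^ e) (ppow_ne_zero p e) r₀ G + R)
    (hr₀ : r₀ < p ^ e) (hR : ResIn (p ^ e) good R) (hgood : ∀ ρ, good ρ → PairLTP p ρ r₀) (he : 0 < e) (hle : e ≤ ℓ)
    (h0 : 0 < frontierLength X.support X.u) {k : ℕ} (hk : PowerSeries.order G = k) (hsole : SoleBottom p e ℓ X.support X.u)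
    {w : MvPowerSeries (Fin 1) K} (hw : w * uStar X.support X.u = 1) :
    w = psiQ (p ^ e) (ppow_ne_zero p e) (ReducedRun.unitPart (p ^ (ℓ - e)) k G)⁻¹ := by
  set u := ReducedRun.unitPart (p ^ (ℓ - e)) k G with hu
  have hu0 : PowerSeries.constantCoeff u ≠ 0 := by
    rw [hu, ReducedRun.constantCoeff_unitPart]; exact (PowerSeries.order_eq_nat.mp hk).1
  have hinv : psiQ (p ^ e) (ppow_ne_zero p e) u * psiQ (p ^ e) (ppow_ne_zero p e) u⁻¹ = 1 := by
    rw [← map_mul, PowerSeries.mul_inv_cancel u hu0, map_one]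
  rw [uStar_of_levelP X hF hr₀ hR hgood he hle h0 hk hsole] at hw
  calc w = w * (psiQ _ _ u * psiQ _ _ u⁻¹) := by rw [hinv, mul_one]
    _ = psiQ _ _ u⁻¹ := by rw [← mul_assoc, hw, one_mul]

end Datum

end ReducedBridgeP

end CampaignW24

end Summit.ResolutionOfSingularities.ResolutionOfSingularities.Theorems

end
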